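import Summits.FinalStateConjecture.FinalStateConjecture.Theorems.KerrShieldedDataExist.Negative.BentSlopeBounds
import Literature.NumberTheory.Sieve.GreenTao2008PseudorandomMajorantProofs
import Literature.Topology.FourManifolds.SubsphereLevel
import HarnessLib

/-!
# `KerrShieldedSettles` — negative lemma: the STATIONARY bent hole clock is dead (exact constants)

Support / refuted-approach lemma for crux `stmt-FinalStateConjecture-10054`
(`Summit.FinalStateConjecture.FinalStateConjecture.Theses.SwallowTheDatum.KerrShieldedSettles`, route
SwallowTheDatum), from the standing disprover's work file `Cruxes/KerrShieldedSettles/Disproof.lean` §G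
(rev 4), landed so that provers / planners / ideators can import it.  Concurs with the crux triage
(TRIAGE-r1-2 T2, TRIAGE-r1-3 L1), whose number `0.63` it makes exact.

The conclusion of the crux asks for an `N = 1` `FinalStateDecomposition` whose hole chart satisfies
`tendsto_truncDeviationCk i R` for EVERY fixed near-zone radius `R` (KerrConvergence.lean).  A hole chart
bent by a time-INDEPENDENT height, `Ψ_B(x⁰, x) = (x⁰ + B(r(x)), x)` in ingoing Kerr–Schild coordinates,
has `dΨ_B(∂_{x⁰}) = ∂_{t*}`, `dΨ_B(∂_r) = ∂_r + B′ ∂_{t*}`, so `Ψ_B^* g − g_KS` (the reference form is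
`t*`-independent; trivial motion, `boostedKerrBilin_one_zero`) has `(∂_{x⁰}, ∂_r)`-component
`B′(r) g₀₀ = −(1 − 2M/r) B′(r)` for `a = 0`, independent of `x⁰`.  `IsLateChart.image_subset ⊆ O ⊆ J⁺(ιX)`
forces the bend to follow the slice height `T = bentHeight M a` far out, and for `B = T`, `a = 0`,
`r = 6M` the slope is EXACT: `T′(6M) = χ′(½)·(2M log 2)/(4M) + χ(½)·F′(6M) = log 2 + 1/4`
(`χ = Real.smoothTransition`, `χ(½) = ½`, `χ′(½) = 2` — so the tree's bound
`deriv_smoothTransition_le_two` is SHARP), whence the component `−(2/3)(log 2 + 1/4) = −0.6288…` on every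
slab `{x⁰ = τ}`; as the operator norm dominates components on unit vectors,
`truncDeviationCk … R τ ≥ 5/8` for all `τ`, all `k`, all `R ≥ 6M`, and the convergence clause FAILS.
Hence the hole chart's bend must recede in `x⁰` (Disproof.lean §C3: `B(x⁰, r) = c₀ + T(r)·χ((r − 2R(x⁰))/R(x⁰))`,
`R(x⁰) → ∞`); the flat chart may keep the stationary bend (its slabs live on `{r > ρ(τ) → ∞}`).
Two companions (same work file, §G′ and §H1′): the LOGARITHMIC GROWTH of the slice,
`T(r) ≤ 2M log((r − 2M)/(2M)) ≤ 2M log(r/M)` on `[4M, ∞)` uniformly in `|a| < M` (from the sibling lane's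
tortoise comparison `blHeight_sub_le`), which is the quantitative reason the RECEDING bend satisfies
`image_subset` (`T(3R(x⁰)) ≤ x⁰ + c₀`: log versus linear) and injectivity in `x⁰`
(`|∂B/∂x⁰| ≤ 2·T(3R)·3/(2√x⁰ R) → 0`); and the three ingoing-Eddington–Finkelstein sign facts
(`a = 0`: future causal ⇒ `dv ≥ 0`, with equality only for the ingoing principal null direction; inside the
hole future causal ⇒ `dr < 0`) behind the disprover's load-bearing analysis "completeness / `IsSoleEnd` cannot
be dropped" (the coreless exact slice has sojourn-incomplete `𝓘⁺`: `J⁺(ιB₀) ⊆ {v ≥ inf v}` while the inner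
collar's ingoing principal rays keep `v` smaller and leave `D⁺(Σ₁)` in affine time `O(ε)`).
Everything here is exact real arithmetic about the literal route height (`bentHeight`, `bentSlope`,
`deriv_bentHeight`, `blHeight_sub_le` of `KerrShieldedDataExist/Negative/{BentHeight,BentSlopeBounds}.lean`).
References: Dafermos–Rodnianski arXiv:0811.0354 §5.1 (ingoing Kerr–Schild / Boyer–Lindquist clocks);
DHRT arXiv:2104.08222 §1 (near-zone `Cᵏ` convergence).
-/

noncomputable section

open Real Set

namespace Summit.FinalStateConjecture.FinalStateConjecture.Theorems.KerrShieldedSettles.Negative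

open Literature.Geometry.Lorentzian
open Literature.NumberTheory.Sieve.GreenTao2008 (hasDerivAt_smoothTransition)
open Literature.Topology.FourManifolds.CappedBallLid (smoothTransition_one_half)
open Summit.FinalStateConjecture.FinalStateConjecture.Theorems.KerrShieldedDataExist.Negative
  (blHeight bentHeight bentSlope deriv_bentHeight mass_pos bentHeight_eq_zero_of_le blHeight_sub_nonneg
  blHeight_sub_le)

/-! ## The two exact cutoff constants -/

-- `χ(½) = ½` is the tree's `Literature.Topology.FourManifolds.CappedBallLid.smoothTransition_one_half`.

/-- **`χ′(½) = 2`**: the supremum `2` of `χ′` is attained, so the tree's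
`Literature.NumberTheory.Sieve.GreenTao2008.deriv_smoothTransition_le_two` is sharp. [folklore] -/
theorem deriv_smoothTransition_one_half : deriv Real.smoothTransition (1 / 2) = 2 := by
  rw [(hasDerivAt_smoothTransition (1 / 2)).deriv, show (1 : ℝ) - 1 / 2 = 1 / 2 by norm_num]
  have h : 0 < expNegInvGlue (1 / 2) := expNegInvGlue.pos_of_pos (by norm_num)
  field_simp
  ring

/-! ## Schwarzschild (`a = 0`) specialisations of the route height -/

/-- `r₊ = 2M` for `a = 0`, `0 ≤ M`. [folklore] -/
theorem rPlus_spin_zero {M : ℝ} (hM : 0 ≤ M) : Kerr.rPlus M 0 = 2 * M := by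
  unfold Kerr.rPlus
  rw [show M ^ 2 - (0 : ℝ) ^ 2 = M ^ 2 by ring, Real.sqrt_sq hM]
  ring

/-- `r₋ = 0` for `a = 0`, `0 ≤ M`. [folklore] -/
theorem rMinus_spin_zero {M : ℝ} (hM : 0 ≤ M) : Kerr.rMinus M 0 = 0 := by
  unfold Kerr.rMinus
  rw [show M ^ 2 - (0 : ℝ) ^ 2 = M ^ 2 by ring, Real.sqrt_sq hM]
  ring

/-- Schwarzschild tortoise height: `F(r) = 2M log(r − 2M)` for `a = 0`. [cite: arXiv08110354, §5.1] -/
theorem blHeight_spin_zero {M : ℝ} (hM : 0 < M) (r : ℝ) :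
    blHeight M 0 r = 2 * M * Real.log (r - 2 * M) := by
  unfold blHeight
  rw [rPlus_spin_zero hM.le, rMinus_spin_zero hM.le,
    show M ^ 2 - (0 : ℝ) ^ 2 = M ^ 2 by ring, Real.sqrt_sq hM.le, div_self hM.ne']
  ring

/-- **The exact slope of the route's bent height at `r = 6M` (Schwarzschild):**
`T′(6M) = log 2 + 1/4 ≈ 0.943`. [folklore] -/
theorem bentSlope_six_mul_spin_zero {M : ℝ} (hM : 0 < M) :
    bentSlope M 0 (6 * M) = Real.log 2 + 1 / 4 := by
  unfold bentSlope
  have h1 : 6 * M / (4 * M) - 1 = 1 / 2 := by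
    field_simp
    ring
  rw [h1, deriv_smoothTransition_one_half, smoothTransition_one_half, blHeight_spin_zero hM,
    blHeight_spin_zero hM]
  have e1 : (6 * M - 2 * M : ℝ) = 2 * (2 * M) := by ring
  have e2 : (4 * M - 2 * M : ℝ) = 2 * M := by ring
  have e3 : ((6 * M) ^ 2 - 2 * M * (6 * M) + (0 : ℝ) ^ 2) = 24 * M ^ 2 := by ring
  rw [e1, e2, e3, Real.log_mul (by norm_num) (by positivity)]
  have hM' : M ≠ 0 := hM.ne'
  have h24 : (24 : ℝ) * M ^ 2 ≠ 0 := by positivity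
  field_simp
  ring

/-- The same for `deriv (bentHeight M 0)`. [folklore] -/
theorem deriv_bentHeight_six_mul_spin_zero {M : ℝ} (hM : 0 < M) :
    deriv (bentHeight M 0) (6 * M) = Real.log 2 + 1 / 4 := by
  have ha : |(0 : ℝ)| < M := by simpa using hM
  rw [deriv_bentHeight ha, bentSlope_six_mul_spin_zero hM]

/-! ## The dead clock

The `(∂_{x⁰}, ∂_r)` component of `Ψ_T^* g − g_KS` for the stationary bend by the route height (`a = 0`, any
point at Kerr–Schild radius `r`, by spherical symmetry) is `−(1 − 2M/r)·T′(r)` (`dΨ(∂₀) = ∂_{t*}`,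
`dΨ(∂_r) = ∂_r + T′∂_{t*}` give `g(∂_{t*}, ∂_r + T′∂_{t*}) = g_{0r} + T′ g₀₀` with `g₀₀ = −1 + 2M/r`).  We keep
it as the literal expression `-(1 - 2 * M / r) * bentSlope M 0 r` (no new definition). -/

/-- **Exact value of the stationary-bend deviation component at `r = 6M`:** `−(2/3)(log 2 + 1/4)`, the
same on every slab `{x⁰ = τ}`. [folklore] -/
theorem stationaryBend_dev_six_mul {M : ℝ} (hM : 0 < M) :
    -(1 - 2 * M / (6 * M)) * bentSlope M 0 (6 * M) = -(2 / 3) * (Real.log 2 + 1 / 4) := by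
  rw [bentSlope_six_mul_spin_zero hM]
  have hM' : M ≠ 0 := hM.ne'
  field_simp
  ring

/-- **The stationary bent hole clock is dead** (refuted approach to crux 10054): the `τ`-independent
deviation component at `r = 6M` exceeds `5/8` in absolute value (true value `0.6288…`), so the truncated
`Cᵏ` deviation of the stationary-bent hole chart on `{x⁰ = τ, r ≤ R}`, `R ≥ 6M`, is `≥ 5/8` for every
`τ` and `FinalStateDecomposition.tendsto_truncDeviationCk i R` fails for every `k`. [folklore] -/
theorem abs_stationaryBend_dev_six_mul_gt {M : ℝ} (hM : 0 < M) :
    (5 : ℝ) / 8 < |-(1 - 2 * M / (6 * M)) * bentSlope M 0 (6 * M)| := by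
  rw [stationaryBend_dev_six_mul hM]
  have h2 := Real.log_two_gt_d9
  have hneg : -(2 / 3) * (Real.log 2 + 1 / 4) < 0 := by nlinarith
  rw [abs_of_neg hneg]
  nlinarith

/-- In particular the component is bounded AWAY from zero uniformly in the slab time `τ`, which is the
form in which "`→ 0` fails" is consumed. [folklore] -/
theorem not_tendsto_stationaryBend_dev {M : ℝ} (hM : 0 < M) :
    ¬ Filter.Tendsto (fun _τ : ℝ => |-(1 - 2 * M / (6 * M)) * bentSlope M 0 (6 * M)|)
      Filter.atTop (nhds 0) := by
  intro h
  have hc := abs_stationaryBend_dev_six_mul_gt hM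
  have := tendsto_nhds_unique h tendsto_const_nhds
  linarith

/-! ## Logarithmic growth of the slice (why receding bends work) -/

/-- **`T(r) ≤ 2M·log((r − 2M)/(2M))`** for `4M ≤ r`, uniformly in `|a| < M` (`χ ≤ 1` times the tortoise
comparison `blHeight_sub_le`). [cite: arXiv08110354, §5.1] -/
theorem bentHeight_le_log {M a r : ℝ} (h : |a| < M) (hr : 4 * M ≤ r) :
    bentHeight M a r ≤ 2 * M * Real.log ((r - 2 * M) / (2 * M)) := by
  have h0 := blHeight_sub_nonneg h hr
  have hχ1 : Real.smoothTransition (r / (4 * M) - 1) ≤ 1 := Real.smoothTransition.le_one _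
  have hT : bentHeight M a r ≤ blHeight M a r - blHeight M a (4 * M) := by
    have := mul_le_mul_of_nonneg_right hχ1 h0
    simpa [bentHeight] using this
  exact hT.trans (blHeight_sub_le h hr)

/-- Cruder but handier: **`T(r) ≤ 2M·log(r/M)`** on all of `[M, ∞)` (`T = 0` below `4M`). [folklore] -/
theorem bentHeight_le_two_mul_log {M a r : ℝ} (h : |a| < M) (hr : M ≤ r) :
    bentHeight M a r ≤ 2 * M * Real.log (r / M) := by
  have hM := mass_pos h
  rcases le_or_gt (4 * M) r with h4 | h4
  · refine (bentHeight_le_log h h4).trans ?_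
    apply mul_le_mul_of_nonneg_left _ (by linarith)
    apply Real.log_le_log (by apply div_pos <;> linarith)
    rw [div_le_div_iff₀ (by linarith) hM]
    nlinarith
  · rw [bentHeight_eq_zero_of_le hM h4.le]
    have : 1 ≤ r / M := by rwa [le_div_iff₀ hM, one_mul]
    have := Real.log_nonneg this
    positivity

/-! ## The three ingoing-Eddington–Finkelstein sign facts (`a = 0`)

`g = −(1 − 2M/r) dv² + 2 dv dr + r² dΩ²`, time orientation `−g♯dt*`, `t* = v − r`, so a tangent vector
with components `(dv, dr)` and angular norm-square `w2 ≥ 0` is causal iff `hc` below and future-directed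
iff moreover `dv − dr > 0`. -/

/-- Future-directed causal ⇒ `dv ≥ 0` (any `r > 0`, `M ≥ 0`): `v` is non-decreasing along future causal
curves, so `J⁺(S) ⊆ {v ≥ inf_S v}`. O'Neill 1995, Ch. 2 (Kerr causal structure; here `a = 0`). [folklore] -/
theorem ef_dv_nonneg {M r dv dr w2 : ℝ} (hM : 0 ≤ M) (hr : 0 < r) (hw : 0 ≤ w2)
    (hc : -(1 - 2 * M / r) * dv ^ 2 + 2 * dv * dr + r ^ 2 * w2 ≤ 0) (hf : dr < dv) : 0 ≤ dv := by
  by_contra h'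
  have h'' : dv < 0 := not_le.mp h'
  have hMr : 0 ≤ 2 * M / r := by positivity
  nlinarith [mul_pos_of_neg_of_neg h'' h'', sq_nonneg dr, mul_nonneg hMr (sq_nonneg dv),
    mul_nonneg (sq_nonneg r) hw, mul_neg_of_pos_of_neg (sub_pos.2 hf) h'']

/-- … with `dv = 0` only for the ingoing principal null direction (`dr < 0`, no angular part). [folklore] -/
theorem ef_dv_eq_zero {M r dv dr w2 : ℝ} (hr : 0 < r) (hw : 0 ≤ w2)
    (hc : -(1 - 2 * M / r) * dv ^ 2 + 2 * dv * dr + r ^ 2 * w2 ≤ 0) (hf : dr < dv) (h0 : dv = 0) :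
    dr < 0 ∧ w2 = 0 := by
  subst h0
  refine ⟨hf, ?_⟩
  have : r ^ 2 * w2 ≤ 0 := by nlinarith
  have hr2 : 0 < r ^ 2 := by positivity
  nlinarith [mul_nonneg hr2.le hw]

/-- Inside the hole (`0 < r < 2M`): future-directed causal ⇒ `dr < 0` — `r` is a time function in the
black-hole region, the fact behind "the core's future stays inside" and behind the exit estimate of the
coreless counterexample. O'Neill 1995, Ch. 2. [folklore] -/
theorem ef_dr_neg_inside {M r dv dr w2 : ℝ} (hM : 0 ≤ M) (hr : 0 < r) (hrM : r < 2 * M)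
    (hw : 0 ≤ w2) (hc : -(1 - 2 * M / r) * dv ^ 2 + 2 * dv * dr + r ^ 2 * w2 ≤ 0) (hf : dr < dv) :
    dr < 0 := by
  have hdv := ef_dv_nonneg hM hr hw hc hf
  have hf' : 1 - 2 * M / r < 0 := by
    rw [sub_neg, lt_div_iff₀ hr]
    linarith
  by_contra h'
  have h'' : 0 ≤ dr := not_lt.mp h'
  have hdvpos : 0 < dv := lt_of_le_of_lt h'' hf
  nlinarith [mul_nonneg hdv h'', mul_pos_of_neg_of_neg hf' (show -(dv ^ 2) < 0 by nlinarith),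
    mul_nonneg (sq_nonneg r) hw]

/-- The `v`-drop rate `2ρ/(2M − ρ)` of the past-directed outgoing null direction inside the hole is
monotone in `ρ ∈ [0, 2M)` (turns the exit estimate into `η > ε(2M − r₁)/(2r₁) + o(ε)`). [folklore] -/
theorem drop_rate_mono {M ρ ρ' : ℝ} (h0 : 0 ≤ ρ) (h1 : ρ ≤ ρ') (h2 : ρ' < 2 * M) :
    2 * ρ / (2 * M - ρ) ≤ 2 * ρ' / (2 * M - ρ') := by
  rw [div_le_div_iff₀ (by linarith) (by linarith)]
  nlinarith

end Summit.FinalStateConjecture.FinalStateConjecture.Theorems.KerrShieldedSettles.Negative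

end
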